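import Summits.ABC.IUTFork.Cor312UnitThm311
import HarnessLib

/-!
# [IUTchIII] Cor. 3.12 — the COSET test model, I: regions the indeterminacies MOVE, admissible coset pairs, typed Theorem 3.11

Record-only file (D-0012; MODEL DATA, no `Prop` fact, nothing asserted about print) of the abc-iut cell (wave-4 prover abc-iut-w4-d101,
gen 4 — author lineage of the countermodel of record `Cor312Vol.PinnedWitness.pinned_countermodel`, p419720). TAKES NO SIDE on [IUTchIII]
Cor. 3.12. Over part I's `p`-adic UNIT shells (`UnitWitness.unitShells`, p429139: the indeterminacy group `⟨(Ind1) ∪ (Ind2)⟩` is the infinite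
group of unit multiplications on the packet lines).

PURPOSE (abc-iut-w5-d031 2026-08-26T06:44:37Z «a model whose ⟨Ind1 ∪ Ind2⟩ MOVES the Θ-region is what is missing»; abc-iut-rp-cx
06:31:03Z §2 MODEL-SPACE (a)/(b); abc-iut-w5-d068 p429312 `Cor312PinnedIndTrivial`: in EVERY pinned model of record the possible images of the
Θ-pilot object are the singleton of one ball, so the holomorphic hull of [IUTchIII] Cor. 3.12 (kurims `paper:url-4b091feeb646` p. 174 l. 50 –
p. 175 l. 1 «the holomorphic hull of the union of the possible images») does no work). This part supplies regions that units DO move and a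
typed-Thm-3.11 situation whose admissible regions contain them:
* `coset p j vQ c` — the PRINCIPAL-UNIT COSET `c·(1 + p𝒪) = {x | v_p(x − c) ≥ v_p(c) + 1}` of the packet line (`c ≠ 0`; for `c = 0` the point `0`),
  `pair c := coset c ∪ coset (−c)`; a family acting by the unit `ε` maps `coset c` onto `coset (ε·c)` (`image_coset_of_actsByUnits`) — so units
  `≢ ±1 (mod p)` MOVE the pairs, while the sign twist fixes them;
* `Adm'`/`vol'` — admissible regions = the balls `B_k` AND the pairs; `μ(B_k) = −k·log p`, `μ(pair c) = −(v_p(c)+1)·log p` (the volume of ONE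
  coset: a lower normalisation, only its MONOTONICITY is consumed); both CLASS and VOLUME are invariant under every unit family
  (`adm'_image_iff`, `vol'_image`); `vol'_mono`;
* `cData`/`cLine n := cData.map (lineFam n)`/`cFull` — the data (a)(b)(c) (splitting monoid abc-iut-w5-d247's `Ψ_v = {(±q^{j²})_j}`), lines
  transported by the units `u₀^n` (distinct lines as in part II), columns read through w5-d247's sign twist, link data `naiveLink`; and
  **`cFull_statement` — the typed [IUTchIII] Theorem 3.11 (i) ∧ (ii) ∧ (iii) HOLDS** (KummerA now by unit-invariance of the admissible class).
Part II (`Cor312UnitCosetCountermodel`) builds the pin-respecting Cor. 3.12 setting whose Θ-pilot Kummer images are the PAIRS `±q^{j²}·(1+p𝒪)`: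
several distinct possible images, hull `B_{j²}` strictly larger than each — genuine inflation — and still `¬S`. Interface-level, one place
(`toyIndex`, `l⋇ = 2`); not a model of initial Θ-data. [claim: Mochizuki2012, status: disputed] [cite: ScholzeStix2018, §2.2 pp. 9–10]
-/

noncomputable section

namespace Summit.ABC.IUTFork.Cor312Vol.UnitCoset

open Set Thm311 Cor312 Cor312.Checks Cor312.IdentifiedNonVacuity NaiveWitness UnitWitness Literature.IUT.LogThetaLattice

variable (p : ℕ) [hp : Fact p.Prime]

/-! ## 1. Principal-unit cosets and sign pairs on the packet lines -/

omit hp in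
/-- **The principal-unit coset** `c·(1 + p𝒪) = {x | v_p(line x − c) ≥ v_p(c) + 1}` of a packet line (`c ≠ 0`); for `c = 0` the set
`{line = 0}`. [claim: Mochizuki2012, status: disputed] -/
def coset (j : toyIndex.Label) (vQ : toyIndex.VQ) (c : ℚ) : Set ((unitShells p).Packet j vQ) :=
  {x | line j vQ x = c ∨ (c ≠ 0 ∧ padicValRat p c + 1 ≤ padicValRat p (line j vQ x - c))}

omit hp in
/-- **The sign pair** `±c·(1 + p𝒪)`. [claim: Mochizuki2012, status: disputed] -/
def pair (j : toyIndex.Label) (vQ : toyIndex.VQ) (c : ℚ) : Set ((unitShells p).Packet j vQ) := coset p j vQ c ∪ coset p j vQ (-c)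

omit hp in
/-- Membership in a coset, on coordinates. [folklore] -/
theorem mem_coset_iff (j : toyIndex.Label) (vQ : toyIndex.VQ) (c : ℚ) (x : (unitShells p).Packet j vQ) :
    x ∈ coset p j vQ c ↔ line j vQ x = c ∨ (c ≠ 0 ∧ padicValRat p c + 1 ≤ padicValRat p (line j vQ x - c)) := Iff.rfl

omit hp in
/-- The point of coordinate `c` lies in `coset c`. [folklore] -/
theorem rep_mem_coset (j : toyIndex.Label) (vQ : toyIndex.VQ) (c : ℚ) : (line j vQ).symm c ∈ coset p j vQ c :=
  Or.inl (LinearEquiv.apply_symm_apply _ _)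

omit hp in
/-- … and in `pair c`. [folklore] -/
theorem rep_mem_pair (j : toyIndex.Label) (vQ : toyIndex.VQ) (c : ℚ) : (line j vQ).symm c ∈ pair p j vQ c :=
  Or.inl (rep_mem_coset p j vQ c)

/-- The valuation arithmetic of a coset: for `c ≠ 0`, `y = c ∨ v(c) + 1 ≤ v(y − c)` forces `y ≠ 0` and `v(y) = v(c)`. [folklore] -/
theorem val_of_memCoset {c y : ℚ} (hc : c ≠ 0) (h : y = c ∨ (c ≠ 0 ∧ padicValRat p c + 1 ≤ padicValRat p (y - c))) :
    y ≠ 0 ∧ padicValRat p y = padicValRat p c := by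
  rcases h with rfl | ⟨-, h⟩
  · exact ⟨hc, rfl⟩
  · by_cases hyc : y - c = 0
    · obtain rfl : y = c := sub_eq_zero.1 hyc
      exact ⟨hc, rfl⟩
    · have hy : y ≠ 0 := by
        rintro rfl
        rw [zero_sub, padicValRat.neg] at h
        linarith
      refine ⟨hy, ?_⟩
      have hsum : c + (y - c) ≠ 0 := by rw [add_sub_cancel]; exact hy
      have := padicValRat.add_eq_of_lt (p := p) hsum hc hyc (by linarith)
      rwa [add_sub_cancel] at this

/-- Members of `coset c` (`c ≠ 0`) have nonzero coordinate of valuation `v(c)`. [folklore] -/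
theorem val_of_mem_coset {j : toyIndex.Label} {vQ : toyIndex.VQ} {c : ℚ} (hc : c ≠ 0) {x : (unitShells p).Packet j vQ}
    (hx : x ∈ coset p j vQ c) : line j vQ x ≠ 0 ∧ padicValRat p (line j vQ x) = padicValRat p c :=
  val_of_memCoset p hc hx

/-- Members of `pair c` (`c ≠ 0`) have nonzero coordinate of valuation `v(c)`. [folklore] -/
theorem val_of_mem_pair {j : toyIndex.Label} {vQ : toyIndex.VQ} {c : ℚ} (hc : c ≠ 0) {x : (unitShells p).Packet j vQ}
    (hx : x ∈ pair p j vQ c) : line j vQ x ≠ 0 ∧ padicValRat p (line j vQ x) = padicValRat p c := by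
  rcases hx with hx | hx
  · exact val_of_mem_coset p hc hx
  · have h := val_of_mem_coset p (neg_ne_zero.2 hc) hx
    exact ⟨h.1, h.2.trans (padicValRat.neg c)⟩

/-- `0 ∉ pair c` for `c ≠ 0`. [folklore] -/
theorem zero_not_mem_pair (j : toyIndex.Label) (vQ : toyIndex.VQ) {c : ℚ} (hc : c ≠ 0) :
    (0 : (unitShells p).Packet j vQ) ∉ pair p j vQ c := fun h =>
  (val_of_mem_pair p hc h).1 (map_zero _)

/-- A pair is never a ball (`0 ∈ B_k`). [folklore] -/
theorem pair_ne_uBall (j : toyIndex.Label) (vQ : toyIndex.VQ) {c : ℚ} (hc : c ≠ 0) (k : ℤ) : pair p j vQ c ≠ uBall p j vQ k :=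
  fun h => zero_not_mem_pair p j vQ hc (h ▸ zero_mem_uBall p j vQ k)

/-- A ball is never inside a pair. [folklore] -/
theorem not_uBall_subset_pair (j : toyIndex.Label) (vQ : toyIndex.VQ) {c : ℚ} (hc : c ≠ 0) (k : ℤ) :
    ¬ uBall p j vQ k ⊆ pair p j vQ c := fun h => zero_not_mem_pair p j vQ hc (h (zero_mem_uBall p j vQ k))

/-- `pair c ⊆ B_k` iff `k ≤ v(c)`. [folklore] -/
theorem pair_subset_uBall_iff (j : toyIndex.Label) (vQ : toyIndex.VQ) {c : ℚ} (hc : c ≠ 0) (k : ℤ) :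
    pair p j vQ c ⊆ uBall p j vQ k ↔ k ≤ padicValRat p c := by
  constructor
  · intro h
    have h1 := h (rep_mem_pair p j vQ c)
    rw [mem_uBall_iff, LinearEquiv.apply_symm_apply] at h1
    exact h1.resolve_left hc
  · intro h x hx
    have hv := val_of_mem_pair p hc hx
    rw [mem_uBall_iff]
    exact Or.inr (h.trans hv.2.symm.le)

/-- Equal pairs have representatives of equal valuation. [folklore] -/
theorem val_eq_of_pair_eq {j : toyIndex.Label} {vQ : toyIndex.VQ} {c c' : ℚ} (hc' : c' ≠ 0)
    (h : pair p j vQ c = pair p j vQ c') : padicValRat p c = padicValRat p c' := by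
  have h1 : (line j vQ).symm c ∈ pair p j vQ c' := h ▸ rep_mem_pair p j vQ c
  have h2 := (val_of_mem_pair p hc' h1).2
  rwa [LinearEquiv.apply_symm_apply] at h2

/-- Multiplying coordinate and centre by a unit does not change coset membership. [folklore] -/
theorem memCoset_mul_iff {ε : ℚ} (hε : IsPUnit p ε) (c y : ℚ) :
    (ε * y = ε * c ∨ (ε * c ≠ 0 ∧ padicValRat p (ε * c) + 1 ≤ padicValRat p (ε * y - ε * c))) ↔
      (y = c ∨ (c ≠ 0 ∧ padicValRat p c + 1 ≤ padicValRat p (y - c))) := by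
  refine or_congr (mul_right_inj' hε.1) ?_
  rw [← mul_sub]
  by_cases hc : c = 0
  · subst hc; simp
  · rw [padicValRat.mul hε.1 hc, hε.2, zero_add]
    refine and_congr ⟨fun _ => hc, fun _ => mul_ne_zero hε.1 hc⟩ ?_
    by_cases hyc : y - c = 0
    · rw [hyc, mul_zero]
    · rw [padicValRat.mul hε.1 hyc, hε.2, zero_add]

/-- **A family acting by units maps `coset c` ONTO `coset (ε·c)`**, `ε` its unit at the packet. [folklore] -/
theorem image_coset_of_unit {Φ : (unitShells p).PacketAut} {j : toyIndex.Label} {vQ : toyIndex.VQ} {ε : ℚ} (hε : IsPUnit p ε)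
    (hΦ : ∀ x : (unitShells p).Packet j vQ, line j vQ (Φ j vQ x) = ε * line j vQ x) (c : ℚ) :
    Φ j vQ '' coset p j vQ c = coset p j vQ (ε * c) := by
  apply Set.Subset.antisymm
  · rintro _ ⟨x, hx, rfl⟩
    rw [mem_coset_iff, hΦ, memCoset_mul_iff p hε]
    exact hx
  · intro x hx
    refine ⟨(Φ j vQ).symm x, ?_, LinearEquiv.apply_symm_apply _ _⟩
    have h1 := hΦ ((Φ j vQ).symm x)
    rw [LinearEquiv.apply_symm_apply] at h1
    rw [mem_coset_iff, ← memCoset_mul_iff p hε, ← h1]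
    exact hx

/-- … and `pair c` onto `pair (ε·c)`. [folklore] -/
theorem image_pair_of_unit {Φ : (unitShells p).PacketAut} {j : toyIndex.Label} {vQ : toyIndex.VQ} {ε : ℚ} (hε : IsPUnit p ε)
    (hΦ : ∀ x : (unitShells p).Packet j vQ, line j vQ (Φ j vQ x) = ε * line j vQ x) (c : ℚ) :
    Φ j vQ '' pair p j vQ c = pair p j vQ (ε * c) := by
  unfold pair
  rw [Set.image_union, image_coset_of_unit p hε hΦ, image_coset_of_unit p hε hΦ, mul_neg]

omit hp in
/-- `pair (−c) = pair c`. [folklore] -/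
theorem pair_neg (j : toyIndex.Label) (vQ : toyIndex.VQ) (c : ℚ) : pair p j vQ (-c) = pair p j vQ c := by
  unfold pair; rw [neg_neg, Set.union_comm]

/-! ## 2. Admissible regions (balls and pairs) and their log-volume -/

omit hp in
/-- **Admissible regions**: the balls `B_k` and the pairs `±c·(1+p𝒪)`, `c ≠ 0` ([IUTchIII] Thm. 3.11 (i) (a) «the set of nonempty compact open
subsets» — a sub-family of it). [claim: Mochizuki2012, status: disputed] -/
def Adm' (j : toyIndex.Label) (vQ : toyIndex.VQ) (A : Set ((unitShells p).Packet j vQ)) : Prop :=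
  (∃ k : ℤ, A = uBall p j vQ k) ∨ ∃ c : ℚ, c ≠ 0 ∧ A = pair p j vQ c

open scoped Classical in
omit hp in
/-- **Log-volume**: `μ(B_k) = −k·log p`, `μ(±c(1+p𝒪)) := −(v_p(c)+1)·log p` (the volume of one coset — a lower normalisation; only monotonicity
is consumed downstream), `0` elsewhere. [claim: Mochizuki2012, status: disputed] -/
def vol' (j : toyIndex.Label) (vQ : toyIndex.VQ) (A : Set ((unitShells p).Packet j vQ)) : ℝ :=
  if h : ∃ k : ℤ, A = uBall p j vQ k then -(h.choose : ℝ) * Real.log p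
  else if h' : ∃ c : ℚ, c ≠ 0 ∧ A = pair p j vQ c then -((padicValRat p h'.choose : ℝ) + 1) * Real.log p else 0

/-- `μ(B_k) = −k·log p`. [folklore] -/
theorem vol'_uBall (j : toyIndex.Label) (vQ : toyIndex.VQ) (k : ℤ) : vol' p j vQ (uBall p j vQ k) = -(k : ℝ) * Real.log p := by
  classical
  have h : ∃ k' : ℤ, uBall p j vQ k = uBall p j vQ k' := ⟨k, rfl⟩
  unfold vol'
  rw [dif_pos h, uBall_injective p j vQ h.choose_spec.symm]

/-- `μ(pair c) = −(v(c)+1)·log p`. [folklore] -/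
theorem vol'_pair (j : toyIndex.Label) (vQ : toyIndex.VQ) {c : ℚ} (hc : c ≠ 0) :
    vol' p j vQ (pair p j vQ c) = -((padicValRat p c : ℝ) + 1) * Real.log p := by
  classical
  have h1 : ¬ ∃ k : ℤ, pair p j vQ c = uBall p j vQ k := fun ⟨k, hk⟩ => pair_ne_uBall p j vQ hc k hk
  have h2 : ∃ c' : ℚ, c' ≠ 0 ∧ pair p j vQ c = pair p j vQ c' := ⟨c, hc, rfl⟩
  unfold vol'
  rw [dif_neg h1, dif_pos h2, val_eq_of_pair_eq p hc h2.choose_spec.2.symm]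

/-- **Monotone log-volume** on admissible regions. [folklore] -/
theorem vol'_mono {j : toyIndex.Label} {vQ : toyIndex.VQ} {A B : Set ((unitShells p).Packet j vQ)} (hA : Adm' p j vQ A)
    (hB : Adm' p j vQ B) (hAB : A ⊆ B) : vol' p j vQ A ≤ vol' p j vQ B := by
  have hlog := log_p_pos p
  rcases hA with ⟨k, rfl⟩ | ⟨c, hc, rfl⟩ <;> rcases hB with ⟨k', rfl⟩ | ⟨c', hc', rfl⟩
  · rw [vol'_uBall, vol'_uBall, ← uVol_uBall, ← uVol_uBall]
    exact uVol_mono p hAB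
  · exact absurd hAB (not_uBall_subset_pair p j vQ hc' k)
  · rw [vol'_pair p j vQ hc, vol'_uBall]
    have h : (k' : ℝ) ≤ padicValRat p c := by exact_mod_cast (pair_subset_uBall_iff p j vQ hc k').1 hAB
    nlinarith
  · rw [vol'_pair p j vQ hc, vol'_pair p j vQ hc']
    have h1 := (val_of_mem_pair p hc' (hAB (rep_mem_pair p j vQ c))).2
    rw [LinearEquiv.apply_symm_apply] at h1
    rw [h1]

/-- The admissible class is invariant under a family acting by units (balls to balls, pairs to pairs). [folklore] -/
theorem adm'_image {Φ : (unitShells p).PacketAut} (h : ActsByUnits p Φ) {j : toyIndex.Label} {vQ : toyIndex.VQ}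
    {A : Set ((unitShells p).Packet j vQ)} (hA : Adm' p j vQ A) : Adm' p j vQ (Φ j vQ '' A) := by
  obtain ⟨ε, hε, hΦ⟩ := h.unit j vQ
  rcases hA with ⟨k, rfl⟩ | ⟨c, hc, rfl⟩
  · exact Or.inl ⟨k, image_uBall_of_actsByUnits h j vQ k⟩
  · exact Or.inr ⟨ε * c, mul_ne_zero hε.1 hc, image_pair_of_unit p hε hΦ c⟩

/-- … in both directions. [folklore] -/
theorem adm'_image_iff {Φ : (unitShells p).PacketAut} (h : ActsByUnits p Φ) (j : toyIndex.Label) (vQ : toyIndex.VQ)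
    (A : Set ((unitShells p).Packet j vQ)) : Adm' p j vQ (Φ j vQ '' A) ↔ Adm' p j vQ A := by
  refine ⟨fun hA => ?_, adm'_image p h⟩
  have := adm'_image p h.inv hA
  rwa [show (Φ⁻¹) j vQ '' (Φ j vQ '' A) = A from by
    rw [Set.image_image]; exact (Set.image_congr fun x _ => (Φ j vQ).symm_apply_apply x).trans (Set.image_id _)] at this

/-- The log-volume is invariant under a family acting by units. [folklore] -/
theorem vol'_image {Φ : (unitShells p).PacketAut} (h : ActsByUnits p Φ) (j : toyIndex.Label) (vQ : toyIndex.VQ)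
    (A : Set ((unitShells p).Packet j vQ)) : vol' p j vQ (Φ j vQ '' A) = vol' p j vQ A := by
  classical
  obtain ⟨ε, hε, hΦ⟩ := h.unit j vQ
  by_cases hA : Adm' p j vQ A
  · rcases hA with ⟨k, rfl⟩ | ⟨c, hc, rfl⟩
    · rw [image_uBall_of_actsByUnits h]
    · rw [image_pair_of_unit p hε hΦ, vol'_pair p j vQ (mul_ne_zero hε.1 hc), vol'_pair p j vQ hc,
        padicValRat.mul hε.1 hc, hε.2, zero_add]
  · have hA' : ¬ Adm' p j vQ (Φ j vQ '' A) := fun h' => hA ((adm'_image_iff p h j vQ A).1 h')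
    unfold vol'
    rw [dif_neg (fun h1 => hA' (Or.inl h1)), dif_neg (fun h2 => hA' (Or.inr h2)), dif_neg (fun h1 => hA (Or.inl h1)),
      dif_neg (fun h2 => hA (Or.inr h2))]

/-! ## 3. Data, lines, situation, columns; the typed Theorem 3.11 -/

omit hp in
/-- **The data (a)(b)(c) of line `0`**: integral structures `B_0`; admissible regions the balls AND the pairs, log-volume `vol'`; splitting monoid
abc-iut-w5-d247's `Ψ_v = {(±q^{j²})_j}` acting by multiplication; number-field copy everything. [claim: Mochizuki2012, status: disputed] -/
def cData : MRData (unitShells p) where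
  shellPk := fun j vQ => uBall p j vQ 0
  shellSub := fun j v => uBall p j (toyIndex.over v) 0
  Adm := fun j vQ A => Adm' p j vQ A
  logvol := fun j vQ A => vol' p j vQ A
  Ψ := fun v _ => Psi p v
  act := fun v _ y => LinearMap.pi fun j => (line j.1 (toyIndex.over v) (y j)) • LinearMap.proj j
  Mmod := fun _ => Set.univ

/-- **Line `n`**: the transport of the line-`0` data by the unit `u₀^n` (part II's (Ind2)-family `lineFam`). [claim: Mochizuki2012, status: disputed] -/
def cLine (n : ℤ) : MRData (unitShells p) := (cData p).map (lineFam p n)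

/-- The admissible regions of every line are the balls and the pairs. [folklore] -/
theorem cLine_adm_iff (n : ℤ) (j : toyIndex.Label) (vQ : toyIndex.VQ) (A : Set ((unitShells p).Packet j vQ)) :
    (cLine p n).Adm j vQ A ↔ Adm' p j vQ A :=
  adm'_image_iff p (lineFam_actsByUnits p n).inv j vQ A

/-- The log-volume of every line is `vol'`. [folklore] -/
theorem cLine_logvol (n : ℤ) (j : toyIndex.Label) (vQ : toyIndex.VQ) (A : Set ((unitShells p).Packet j vQ)) :
    (cLine p n).logvol j vQ A = vol' p j vQ A :=
  vol'_image p (lineFam_actsByUnits p n).inv j vQ A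

/-- The integral structure of line `n` is `B_0`. [folklore] -/
theorem cLine_shellPk (n : ℤ) (j : toyIndex.Label) (vQ : toyIndex.VQ) : (cLine p n).shellPk j vQ = uBall p j vQ 0 :=
  image_uBall_of_actsByUnits (lineFam_actsByUnits p n) j vQ 0

/-- The number-field copy of line `n` is everything. [folklore] -/
theorem cLine_Mmod (n : ℤ) (j : toyIndex.LabelStar) : (cLine p n).Mmod j = Set.univ :=
  Set.image_univ_of_surjective ((unitShells p).globalAut (lineFam p n) j.1).surjective

omit hp in
/-- (c)'s global realified Frobenioids: objects `p^k𝒪`, degree `−k·log p`, region `B_k`. [claim: Mochizuki2012, status: disputed] -/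
def cDegrees (j : toyIndex.LabelStar) : GlobalDegrees (unitShells p) j where
  ObjMOD := ℤ
  Objmod := ℤ
  natIso := Equiv.refl ℤ
  deg := fun k => -(k : ℝ) * Real.log p
  region := fun k vQ => uBall p j.1 vQ k

/-- **The COSET SITUATION** (an `abbrev`). [claim: Mochizuki2012, status: disputed] -/
abbrev cSituation : Situation toyIndex where
  L := unitShells p
  D := cLine p
  G := fun _ j => cDegrees p j

/-- **The column `n`**: Frobenius-like data at `(n,m)` = the line-`n` data read through abc-iut-w5-d247's sign twist `(−1)^m`.
[claim: Mochizuki2012, status: disputed] -/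
def cColumn (n : ℤ) : Column (unitShells p) where
  frobAdm := fun m j vQ A => Adm' p j vQ ((twist m : (unitShells p).PacketAut) j vQ '' A)
  frobLogvol := fun m j vQ A => vol' p j vQ ((twist m : (unitShells p).PacketAut) j vQ '' A)
  frobΨ := fun m v hv => (unitShells p).starAut (twist m) v '' (cLine p n).Ψ v hv
  frobMmod := fun m j => (unitShells p).globalAut (twist m) j.1 '' (cLine p n).Mmod j
  unitImage := fun _ m' j vQ => uBall p j vQ ((m' : ℤ) + 1)
  ballImage := fun _ j vQ => uBall p j vQ 0
  ObjLGP := ℤ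
  frobObjLGP := FrobObj
  kumLGP := kum
  ObjLgp := ℤ
  frobObjLgp := FrobObj
  kumLgp := kum
  thetaPilot := fun m => ⟨(1, m), rfl⟩

/-- **The full situation of the coset model.** [claim: Mochizuki2012, status: disputed] -/
abbrev cFull : FullSituation toyIndex where
  toSituation := cSituation p
  col := cColumn p
  link := naiveLink

/-- Line `n` is one indeterminacy move away from line `0`; hence **Thm. 3.11 (i) `MultiradialCompat`** through genuine moves. [folklore] -/
theorem c_multiradialCompat : (cFull p).MultiradialCompat := fun n n' =>
  (MRData.RLGP_eq_iff _ _).2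
    (Relation.EqvGen.trans _ _ _
      (Relation.EqvGen.symm _ _ (Relation.EqvGen.rel _ _ ⟨lineFam p n, Or.inr (lineFam_mem_Ind2Family p n), rfl⟩))
      (Relation.EqvGen.rel _ _ ⟨lineFam p n', Or.inr (lineFam_mem_Ind2Family p n'), rfl⟩))

/-- (i): sub-packets (one place: everything), degree clause on the balls, multiradial compatibility. [folklore] -/
theorem c_partI : (cFull p).PartI := by
  refine ⟨fun n v hv x _ j => ?_, fun n j k => ⟨fun vQ => (cLine_adm_iff p n _ vQ _).2 (Or.inl ⟨k, rfl⟩), Set.toFinite _, ?_⟩,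
    c_multiradialCompat p⟩
  · show x j ∈ signShells.SubPacket j.1 v
    rw [subPacket_eq_top]; trivial
  · rw [finsum_unique]
    exact ((cLine_logvol p n j.1 _ _).trans (vol'_uBall p j.1 _ k)).symm

/-- **(ii) (b) KummerB**: the sign-twisted transport of the line-`n` splitting monoid is the line-`n` splitting monoid. [folklore] -/
theorem cColumn_kummerB (n : ℤ) : (cColumn p n).KummerB (cLine p n) := by
  intro m v hv
  show (unitShells p).starAut (twist m) v '' ((unitShells p).starAut (lineFam p n) v '' Psi p v) =
    (unitShells p).starAut (lineFam p n) v '' Psi p v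
  rw [(twist_actsByUnits p m).image_starAut_comm (lineFam_actsByUnits p n)]
  exact congrArg _ (image_Psi_of_actsBySigns p (twist_actsBySigns m) v)

/-- (ii): KummerA by UNIT-INVARIANCE of the admissible class and of the log-volume (the twist maps pairs to pairs); KummerB; KummerC; (Ind3).
[folklore] -/
theorem c_partII : (cFull p).toLatticeSituation.PartII := by
  intro n
  refine (Column.partII_iff _ _).2 ⟨fun m j vQ A hA => ⟨?_, ?_⟩, cColumn_kummerB p n, fun m j => ?_, ?_⟩
  · exact (adm'_image_iff p (twist_actsByUnits p m) j vQ A).2 ((cLine_adm_iff p n j vQ A).1 hA)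
  · exact (vol'_image p (twist_actsByUnits p m) j vQ A).trans (cLine_logvol p n j vQ A).symm
  · show (unitShells p).globalAut (twist m) j.1 '' (cLine p n).Mmod j = (cLine p n).Mmod j
    exact (congrArg _ (cLine_Mmod p n j)).trans
      ((Set.image_univ_of_surjective ((unitShells p).globalAut (twist m) j.1).surjective).trans (cLine_Mmod p n j).symm)
  · refine ⟨fun m m' j vQ _ => ?_, fun m j vQ h => absurd trivial h⟩
    exact (uBall_mono p j vQ (show (0 : ℤ) ≤ (m' : ℤ) + 1 by omega)).trans (cLine_shellPk p n j vQ).symm.subset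

/-- (iii): as for w5-d247's `naiveFull` (same link data). [folklore] -/
theorem c_partIII : (cFull p).PartIII := by
  refine ⟨naiveLink.partIIIa_holds, naiveLink.partIIIb_holds, ?_, ?_,
    (cFull p).evalCompatUpToInd_of_multiradialCompat (c_multiradialCompat p)⟩
  · refine naiveLink.partIIIc_of_full (fun _ => rfl) fun n m => ?_
    rintro _ ⟨a, rfl⟩
    show unitIso a ≪≫ unitIso ((-1) ^ m.natAbs) = unitIso ((-1) ^ m.natAbs) ≪≫ unitIso a
    rw [unitIso_trans, unitIso_trans, mul_comm]
  · intro n m; exact Thm311.PolyIsoCalc.stabilized_full _ _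

/-- **The typed [IUTchIII] Theorem 3.11 (i) ∧ (ii) ∧ (iii) HOLDS in the coset model.** [folklore] -/
theorem cFull_statement : (cFull p).Statement := ⟨c_partI p, c_partII p, c_partIII p⟩

end Summit.ABC.IUTFork.Cor312Vol.UnitCoset

end
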